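import Summits.HodgeConjecture.HodgeConjecture.Theorems.SignSymmetricPowersLinkPairConjugacy
import Summits.HodgeConjecture.HodgeConjecture.Theorems.SignSymmetricPowersLinkConfluence
import Summits.HodgeConjecture.HodgeConjecture.Theorems.SignSymmetricPowersLinkSameFactor
import Summits.HodgeConjecture.HodgeConjecture.Theorems.SignSymmetricPowersSymmetricA3Plane
import Summits.HodgeConjecture.HodgeConjecture.Theorems.SignSymmetricPowersSymmetricA3Line
import Summits.HodgeConjecture.HodgeConjecture.Theorems.SignSymmetricPowersGenFactors
import Literature.AlgebraicGeometry.HodgeTheory.BettiUniverseOddCupAlternating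
import Literature.AlgebraicGeometry.HodgeTheory.BettiUniverseAxioms
import HarnessLib

/-!
# K1-B piece LINK-G: `stub_signConfluenceLinkG` (route `SignSymmetricPowers`, item stmt-HodgeConjecture-19716)

Line `andre-zariski`, skeleton of record v12f (`276eda50fce4ca90`), registered stub `stub_signConfluenceLinkG`
(signature verbatim).  GRANTED the weak F-DISC-0 (an irreducible equation of the discriminant — a tree theorem,
`exists_irreducible_isHomogeneous_discriminantForm`), F-B2PL (`picardLefschetz_symmetricA3`), F-MC
(`affineHypersurfaceComplement_meridian_isConj`), F-DISC-1 (`discriminant_localBranches_nodal`) and F-PL(uniform)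
(`picardLefschetz_nodalForms_uniform`): for every even `d ≥ 4`, every base point `t` of the ι-even family, each
fixed-node type `p ∈ {e₄, e₀}` and the exchanged pair `(±1:0:1:0:0)`, all small pencil circles `ω` (around a
one-nodal ι-even `f₁` with node `p`) and `ω'` (around the pair member `f₃`), moved to `t`, with transports
`T = U_r(c)` (`τ r = ±r`) and `T' = U_δ(c') U_{τδ}(c')`: SOME `Γ`-conjugate of `δ` pairs non-trivially with `r`.

Assembly (memo K1B-LINKF-PLAN-g23 §1–§3):
* radius `ε₁` = the smaller F-PL(u) radius of `(f₁, g)` and `(f₃, g₃)` (punctured closed pencil discs nonsingular);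
* the symmetric `A₃` confluence for `p` (witness `SignSymmetricPowersSymmetricA3Plane` / `…Line`, with `g₀ := x_j^d`)
  read at `t`: `T₁ᶜ = U_{e₂}(c₀)`, `T₂ᶜ = U_{e₁}(c₀)U_{e₃}(c₀)`, `B(e₁,e₃) = 0`, `(c₀B(e₁,e₂))² = (c₀B(e₂,e₃))² = 1`
  (`SignSymmetricPowersLinkConfluence.exists_confluence_at`);
* `T` is `Γ`-conjugate to `T₁ᶜ` (one-node conjugacy, `SignSymmetricPowersLinkConjugacy`), `T'` to `T₂ᶜ` (pair
  conjugacy, `SignSymmetricPowersLinkPairConjugacy` + `SignSymmetricPowersLinkSameFactor` on prover-A's G2 files);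
* the LINK algebra `SignSymmetricOrbitDataAssembly.exists_link_of_conjugate_confluence`.

Sorry-free; axioms `propext`, `Classical.choice`, `Quot.sound`; no definition, no named fact beyond the stub's own
antecedents.

## References

* [ArnoldGuseinzadeVarchenko2012] Arnold, Gusein-Zade, Varchenko, Singularities of Differentiable Maps II, Part I
  §5.2, §2.9 Thm. 2.15.
* [Shimada2010ZvK] I. Shimada, Lectures on Zariski–van Kampen theorem (arXiv:0906.1074), §3 Prop. 3.4.
* [Deligne1974] P. Deligne, La conjecture de Weil. I, Publ. Math. IHÉS 43 (1974), (5.2)–(5.4).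
* [VoisinHodgeII2003] C. Voisin, Hodge Theory and Complex Algebraic Geometry II (CUP 2003), §2.3, §3.1.2, §3.2.
-/

noncomputable section

set_option linter.dupNamespace false

open CategoryTheory MvPolynomial Topology
open Literature.AlgebraicTopology.SingularHomology
open Literature.AlgebraicGeometry.Motives Literature.AlgebraicGeometry.Motives.UniversalHypersurface
open Literature.AlgebraicGeometry.HodgeTheory Literature.AlgebraicGeometry.HodgeTheory.UniversalHypersurface
open Literature.AlgebraicGeometry.HodgeTheory.BettiUniverse
open Literature.AlgebraicGeometry.FundamentalGroup
open Summit.HodgeConjecture.HodgeConjecture.Theorems.SignSymmetricPowersMeridianOneNode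
open Summit.HodgeConjecture.HodgeConjecture.Theorems.SignSymmetricPowersMeridianChart
open Summit.HodgeConjecture.HodgeConjecture.Theorems.SignSymmetricPowersLinkConjugacy
open Summit.HodgeConjecture.HodgeConjecture.Theorems.SignSymmetricPowersLinkTransport
open Summit.HodgeConjecture.HodgeConjecture.Theorems.SignSymmetricPowersLinkConfluence
open Summit.HodgeConjecture.HodgeConjecture.Theorems.SignSymmetricPowersLinkPairConjugacy
open Summit.HodgeConjecture.HodgeConjecture.Theorems.SignSymmetricPowersLinkSameFactor
open Summit.HodgeConjecture.HodgeConjecture.Theorems.SignSymmetricPowersGenFactors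
open Summit.HodgeConjecture.HodgeConjecture.Theorems.SignSymmetricPowersPencilTransport

namespace Summit.HodgeConjecture.HodgeConjecture.Theorems.SignSymmetricPowersConfluenceLinkG

/-! ### §1 Small lemmas: the co-pencil form `x_j^d`, supports, the datum with `g₀` replaced -/

/-- Replacing the transversal unfolding direction `g₀` of a symmetric `A₃` datum by any form with the two properties
the datum asks of it (`g₀(e_j) ≠ 0`, `a`-invariant). [cite: ArnoldGuseinzadeVarchenko2012, Part I §5.2] -/
theorem isSymmetricA3Datum_replace_g₀ {n : ℕ} {f₁ g₀ g₀' g₂ : MvPolynomial (Fin (n + 2)) ℂ} {j k : Fin (n + 2)}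
    {a : Fin (n + 2) → ℂˣ} (h : IsSymmetricA3Datum f₁ g₀ g₂ j k a)
    (h0 : MvPolynomial.eval (Pi.single j 1) g₀' ≠ 0) (hst : a ∈ diagonalStabilizer g₀') :
    IsSymmetricA3Datum f₁ g₀' g₂ j k a := by
  obtain ⟨h1, h2, h3, h4, h5, h6, h7, -, h9, h10, h11, h12, h13, -, h15, h16⟩ := h
  exact ⟨h1, h2, h3, h4, h5, h6, h7, h0, h9, h10, h11, h12, h13, hst, h15, h16⟩

/-- `x_j^d` has even `(x₀,x₁)`-degree in every monomial when `d` is even. [folklore] -/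
theorem coeff_X_pow_eq_zero_of_odd {d : ℕ} (hd : Even d) (j : Fin 5) (e : Fin 5 →₀ ℕ) (he : ¬ Even (e 0 + e 1)) :
    (X j ^ d : MvPolynomial (Fin 5) ℂ).coeff e = 0 := by
  classical
  rw [coeff_X_pow]
  split_ifs with h
  · exfalso
    apply he
    rw [← h, Finsupp.single_apply, Finsupp.single_apply]
    split_ifs <;> simp [hd]
  · rfl

/-- `x_j^d` vanishes at `q` only together with its gradient (`d ≥ 2`). [folklore] -/
theorem eval_pderiv_X_pow_eq_zero {d : ℕ} (hd : 2 ≤ d) (j : Fin 5) (q : Fin 5 → ℂ)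
    (h0 : MvPolynomial.eval q (X j ^ d : MvPolynomial (Fin 5) ℂ) = 0) (i : Fin 5) :
    MvPolynomial.eval q (pderiv i (X j ^ d : MvPolynomial (Fin 5) ℂ)) = 0 := by
  rw [map_pow, eval_X] at h0
  have hq : q j = 0 := (pow_eq_zero_iff (by omega)).1 h0
  rw [(pderiv i).leibniz_pow, smul_eq_mul, nsmul_eq_mul, map_mul, map_mul, map_pow, eval_X, hq,
    zero_pow (by omega), zero_mul, mul_zero]

/-- `b = g a g⁻¹ ⇒ a = g⁻¹ b (g⁻¹)⁻¹` in a group. [folklore] -/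
theorem eq_inv_conj_of_eq_conj {G : Type*} [Group G] {a b g : G} (h : b = g * a * g⁻¹) :
    a = g⁻¹ * b * g⁻¹⁻¹ := by
  subst h; group

/-- ι-even coefficients ⇒ `M`-support for the parity set. [folklore] -/
theorem isSupportedOn_of_coeff_odd_eq_zero {d : ℕ} {f : MvPolynomial (Fin 5) ℂ}
    (hf : ∀ e : Fin 5 →₀ ℕ, ¬ Even (e 0 + e 1) → f.coeff e = 0) :
    IsSupportedOn 3 d {m : DegIndex 3 d | Even (m.1 0 + m.1 1)} f :=
  fun m hm => hf m.1 hm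

/-! ### §2 The registered stub -/

/-- **`stub_signConfluenceLinkG`** (registered stub LINK-G of the K1-B line `andre-zariski`, skeleton v12f
`276eda50fce4ca90`, signature verbatim; see the module docstring for the statement and the assembly).
[cite: ArnoldGuseinzadeVarchenko2012, Part I §5.2 and §2.9 Thm. 2.15] [cite: Shimada2010ZvK, §3 Prop. 3.4]
[cite: Deligne1974, proof of Thm. (5.4), p. 291] [cite: VoisinHodgeII2003, §3.2.1 Thm. 3.16 and §3.2.2] -/
theorem stub_signConfluenceLinkG :
    open Literature.AlgebraicGeometry.Motives Literature.AlgebraicGeometry.Motives.UniversalHypersurface Literature.AlgebraicGeometry.HodgeTheory Literature.AlgebraicGeometry.HodgeTheory.UniversalHypersurface Literature.AlgebraicGeometry.HodgeTheory.BettiUniverse CategoryTheory.Limits in (∀ (n d : ℕ), 2 ≤ d → ∃ Disc : MvPolynomial (Literature.AlgebraicGeometry.Motives.UniversalHypersurface.DegIndex n d) ℂ, Irreducible Disc ∧ Disc.IsHomogeneous Disc.totalDegree ∧ 0 < Disc.totalDegree ∧ ∀ a : Literature.AlgebraicGeometry.Motives.UniversalHypersurface.DegIndex n d → ℂ, a ∈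 Literature.AlgebraicGeometry.HodgeTheory.singularCoeffs n d ↔ MvPolynomial.eval a Disc = 0) → Literature.AlgebraicGeometry.HodgeTheory.picardLefschetz_symmetricA3 → Literature.AlgebraicGeometry.FundamentalGroup.affineHypersurfaceComplement_meridian_isConj → discriminant_localBranches_nodal → picardLefschetz_nodalForms_uniform → ∀ ⦃d : ℕ⦄, Even d → ∀ (h4 : 4 ≤ d), (let M : Set (DegIndex 3 d) := {m | Even (m.1 0 + m.1 1)}; let γ : Fin 5 → ℂˣ := fun i => if (i : ℕ) < 2 then -1 else 1; let u := familyM ℂ 3 d M; let hu : IsSmoothProjectiveFamily u 3 := isSmoothProjectiveFamily_familyM ℂ 3 d M (by decide) (le_trans (by decide) h4); let hU : IsCohomologicallyLocallyTrivialOn u (Set.univ : Set (ComplexPoints (baseM ℂ 3 d M))) := isCohomologicallyLocallyTrivialOn_familyM 3 d M (by decide) (le_trans (by decide) h4); let toU : C(ComplexPoints (baseM ℂ 3 d M), (Set.univ : Set (ComplexPoints (baseM ℂ 3 d M)))) := ⟨fun s => ⟨s, Set.mem_univ s⟩, continuous_id.subtype_mk _⟩; ∀ (hγ : FixesMonomials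 ℂ 3 d M γ) (t₀ : ComplexPoints (baseM ℂ 3 d M)) (f : MvPolynomial (Fin 5) ℂ) (hf : f.IsHomogeneous d) (hM : IsSupportedOn 3 d M f) (hJ : SmoothHypersurface.IsNonsingularForm ℂ f), let t := classifyingPoint ℂ 3 d M t₀ f; let Y := fiberOver u t; let hY : IsSmoothProjective 3 Y := hu.isSmoothProjective t; let B : LinearMap.BilinForm ℚ (bettiCohomology Y 3) := (cup Y 3 3).compr₂ (tr hY (3 + 3)); let τ : bettiCohomology Y 3 →ₗ[ℚ] bettiCohomology Y 3 := pull (sigmaMFiber ℂ 3 d M γ hγ t) 3; let Γ := (haveI := finite hY 3; ratMonodromyGroup u 3 hU ⟨t, Set.mem_univ _⟩); τ ^ 2 = 1 → (∀ x y, B (τ x) (τ y) = B x y) → (∀ g ∈ Γ, ∀ x, g (τ x) = τ (g x)) → (∀ g ∈ Γ, ∀ x y, B (g x) (g y) = B x y) → ∀ (p : Fin 5 → ℂ), (p = ![0, 0, 0, 0, 1] ∨ p = ![1, 0, 0, 0, 0]) → ∀ (f₁ g : MvPolynomial (Fin 5) ℂ), f₁.IsHomogeneous d → g.IsHomogeneous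 d → IsSupportedOn 3 d M f₁ → IsSupportedOn 3 d M g → IsNodalFormWithNodes f₁ ![p] → (∀ i : Fin 1, MvPolynomial.eval (![p] i) g ≠ 0) → ∀ (f₃ g₃ : MvPolynomial (Fin 5) ℂ), f₃.IsHomogeneous d → g₃.IsHomogeneous d → IsSupportedOn 3 d M f₃ → IsSupportedOn 3 d M g₃ → IsNodalFormWithNodes f₃ ![![1, 0, 1, 0, 0], ![-1, 0, 1, 0, 0]] → (∀ i : Fin 2, MvPolynomial.eval (![![1, 0, 1, 0, 0], ![-1, 0, 1, 0, 0]] i) g₃ ≠ 0) → ∃ ε₁ : ℝ, 0 < ε₁ ∧ ∀ ε ε' : ℝ, 0 < ε → ε < ε₁ → 0 < ε' → ε' < ε₁ → ∀ (s : ComplexPoints (baseM ℂ 3 d M)) (β : Path t s) (ω : Path s s), pointFormM ℂ 3 d M s = f₁ + ((ε : ℝ) : ℂ) • g → IsPencilCircle 3 d f₁ g ε (ω.map (AlgPoints.mapContinuous (toBase ℂ 3 d M)).continuous) → ∀ (s' : ComplexPoints (baseM ℂ 3 d M)) (β' : Path t s') (ω' : Path s' s'), pointFormM ℂ 3 d M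 s' = f₃ + ((ε' : ℝ) : ℂ) • g₃ → IsPencilCircle 3 d f₃ g₃ ε' (ω'.map (AlgPoints.mapContinuous (toBase ℂ 3 d M)).continuous) → ∀ T : bettiCohomology Y 3 ≃ₗ[ℚ] bettiCohomology Y 3, IsRatTransport u 3 hU ⟦((β.trans ω).trans β.symm).map toU.continuous⟧ T → ∀ T' : bettiCohomology Y 3 ≃ₗ[ℚ] bettiCohomology Y 3, IsRatTransport u 3 hU ⟦((β'.trans ω').trans β'.symm).map toU.continuous⟧ T' → ∀ (r δ : bettiCohomology Y 3) (c c' : ℚ) (hr : B r r = 0) (hδ : B δ δ = 0) (hδ' : B (τ δ) (τ δ) = 0), (τ r = r ∨ τ r = -r) → B δ (τ δ) = 0 → T = oneParamTransvectionEquiv B hr c → T' = oneParamTransvectionEquiv B hδ c' * oneParamTransvectionEquiv B hδ' c' → ∃ g ∈ Γ, B r (g δ) ≠ 0) := by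
  intro hD0 hB2 hMC hD1 hPLu d hd h4 M γ u hu hU toU hγ t₀ f hf hM hJ t Y hY B τ Γ hτ2 hτB hΓτ hΓB p hp f₁ g hf₁ hg
    hM₁ hMg hnod hgp f₃ g₃ hf₃ hg₃ hM₃ hMg₃ hnod₃ hgp₃
  have hd1 : 1 ≤ d := le_trans (by decide) h4
  have hd2 : 2 ≤ d := le_trans (by decide) h4
  have hUU := UniversalHypersurface.isCohomologicallyLocallyTrivialOn_family 3 d hd1
  -- the radii of F-PL(uniform)
  obtain ⟨cPL, -, hc⟩ := hPLu 3 d (by norm_num) hd1 hUU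
  obtain ⟨ε₀, hε₀, hsm, -⟩ := hc 1 f₁ g hf₁ hg ![p] hnod hgp
  obtain ⟨ε₀', hε₀', hsm', -⟩ := hc 2 f₃ g₃ hf₃ hg₃ _ hnod₃ hgp₃
  refine ⟨min ε₀ ε₀', lt_min hε₀ hε₀', ?_⟩
  intro ε ε' hε hεε hε' hε'ε s β ω hs hω s' β' ω' hs' hω' T hT T' hT' r δ c c' hr hδ hδ' hτr hBδτ hTeq hT'eq
  have hns : ∀ cc : ℂ, cc ≠ 0 → ‖cc‖ ≤ ε → SmoothHypersurface.IsNonsingularForm ℂ (f₁ + cc • g) :=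
    fun cc hcc hccε => hsm cc hcc (lt_of_le_of_lt hccε (hεε.trans_le (min_le_left _ _)))
  have hns' : ∀ cc : ℂ, cc ≠ 0 → ‖cc‖ ≤ ε' → SmoothHypersurface.IsNonsingularForm ℂ (f₃ + cc • g₃) :=
    fun cc hcc hccε => hsm' cc hcc (lt_of_le_of_lt hccε (hε'ε.trans_le (min_le_right _ _)))
  classical
  -- an irreducible equation of the discriminant, and the distinct prime factors of its restriction
  obtain ⟨Disc, hirr, -, -, hV⟩ := hD0 3 d hd2
  have hDne : killHom ℂ 3 d M Disc ≠ 0 := by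
    intro h0
    have ht : (coeffVector ℂ 3 d (AlgPoints.map (toBase ℂ 3 d M) t)) ∘ (Subtype.val : M → DegIndex 3 d) ∈
        Set.range (fun t : ComplexPoints (baseM ℂ 3 d M) =>
          (coeffVector ℂ 3 d (AlgPoints.map (toBase ℂ 3 d M) t)) ∘ (Subtype.val : M → DegIndex 3 d)) := ⟨t, rfl⟩
    rw [range_coeffChart_eq 3 d M hV, Set.mem_setOf_eq, h0, map_zero] at ht
    exact ht rfl
  obtain ⟨m, h, e, w, hw, hirrh, hna, he, hfac, -⟩ := exists_distinct_irreducible_factors (killHom ℂ 3 d M Disc) hDne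
  -- the symmetric `A₃` datum for `p`, with `g₀ := x_j^d`
  obtain ⟨n', hn'⟩ : ∃ n', d = 2 * n' + 4 := by
    obtain ⟨k, hk⟩ := hd
    exact ⟨k - 2, by omega⟩
  have hXst : ∀ j : Fin 5, γ ∈ diagonalStabilizer (X j ^ d : MvPolynomial (Fin 5) ℂ) := fun j =>
    signUnits_two_mem_diagonalStabilizer _ (coeff_X_pow_eq_zero_of_odd hd j)
  have hX1 : ∀ j : Fin 5, MvPolynomial.eval (Pi.single j (1 : ℂ)) (X j ^ d : MvPolynomial (Fin 5) ℂ) ≠ 0 :=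
    fun j => by rw [map_pow, eval_X, Pi.single_eq_same, one_pow]; exact one_ne_zero
  obtain ⟨fA, g₂A, j, k, hfA, hg₂A, hevfA, hevg₂A, hDat, hpj⟩ : ∃ (fA g₂A : MvPolynomial (Fin 5) ℂ) (j k : Fin 5),
      fA.IsHomogeneous d ∧ g₂A.IsHomogeneous d ∧ (∀ e : Fin 5 →₀ ℕ, ¬ Even (e 0 + e 1) → fA.coeff e = 0) ∧
      (∀ e : Fin 5 →₀ ℕ, ¬ Even (e 0 + e 1) → g₂A.coeff e = 0) ∧
      IsSymmetricA3Datum fA (X j ^ d) g₂A j k γ ∧ p = Pi.single j 1 := by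
    rcases hp with hp | hp
    · obtain ⟨fA, g₀A, g₂A, hfA, -, hg₂A, hevf, -, hevg₂, hDat⟩ :=
        SignSymmetricPowersSymmetricA3Plane.exists_symmetricA3Datum_plane n'
      refine ⟨fA, g₂A, 4, 0, by rw [hn']; exact hfA, by rw [hn']; exact hg₂A, hevf, hevg₂,
        isSymmetricA3Datum_replace_g₀ hDat (hX1 4) (hXst 4), ?_⟩
      rw [hp]; funext i; fin_cases i <;> simp
    · obtain ⟨fA, g₀A, g₂A, hfA, -, hg₂A, hevf, -, hevg₂, hDat⟩ :=
        SignSymmetricPowersSymmetricA3Line.exists_symmetricA3Datum_line n'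
      refine ⟨fA, g₂A, 0, 2, by rw [hn']; exact hfA, by rw [hn']; exact hg₂A, hevf, hevg₂,
        isSymmetricA3Datum_replace_g₀ hDat (hX1 0) (hXst 0), ?_⟩
      rw [hp]; funext i; fin_cases i <;> simp
  have hXh : (X j ^ d : MvPolynomial (Fin 5) ℂ).IsHomogeneous d := by simpa using (isHomogeneous_X ℂ j).pow d
  have hXM : IsSupportedOn 3 d M (X j ^ d : MvPolynomial (Fin 5) ℂ) :=
    isSupportedOn_of_coeff_odd_eq_zero (coeff_X_pow_eq_zero_of_odd hd j)
  have hfAM : IsSupportedOn 3 d M fA := isSupportedOn_of_coeff_odd_eq_zero hevfA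
  have hg₂AM : IsSupportedOn 3 d M g₂A := isSupportedOn_of_coeff_odd_eq_zero hevg₂A
  -- the confluence read at `t`
  obtain ⟨F₁, F₂, G₁, G₂, q, ε₂, s₂, κ, ω₁, ω₂, T₁, T₂, e₁, e₂, e₃, c₀, hF₁h, hF₂h, hG₁h, hG₂h, hF₁M, hF₂M, hG₁M, hG₂M,
    hnodF₁, hG₁e, hnodF₂, hG₂q, hε₂, hns₁, hns₂, hs₁, hs₂, hpc₁, hpc₂, hT₁, hT₂, h13, h12, h23, hT₁x, hT₂x⟩ :=
    exists_confluence_at 3 d M γ hB2 (by norm_num) hd1 hγ hU hfA hXh hg₂A hfAM hXM hg₂AM hDat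
      (fun q' h0 i => eval_pderiv_X_pow_eq_zero hd2 j q' h0 i) t
  -- one-node conjugacy: `T₁ = γ₁ T γ₁⁻¹`
  have hgp' : MvPolynomial.eval (Pi.single j (1 : ℂ)) g ≠ 0 := by
    have := hgp 0; rwa [Matrix.cons_val_fin_one, hpj] at this
  have hnod' : IsNodalFormWithNodes f₁ ![Pi.single j (1 : ℂ)] := by rw [← hpj]; exact hnod
  obtain ⟨γ₁, hγ₁, hc₁⟩ := exists_conj_transport_of_node_at 3 d M hMC hD1 hirr hV (by norm_num) hd1 hw hirrh he hfac hU
    hf₁ hg hF₁h hG₁h hM₁ hMg hF₁M hG₁M hnod' hnodF₁ hgp' hG₁e hε hε₂ hns hns₁ β hs ω hω κ hs₁ ω₁ hpc₁ hT hT₁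
  -- pair conjugacy: `T₂ = γ₂ T' γ₂⁻¹`
  obtain ⟨j₀, hj₀⟩ := exists_factor_of_free_singular hd2 hV hw h he hfac
  have hqplus : IsOrdinaryDoublePointOf f₃ ![1, 0, 1, 0, 0] := by have := hnod₃.1 0; rwa [Matrix.cons_val_zero] at this
  have hqF : IsOrdinaryDoublePointOf F₂ q := by have := hnodF₂.1 0; rwa [Matrix.cons_val_zero] at this
  obtain ⟨⟨i₀, hi₀, hq₀⟩, ⟨i₁, hi₁, hq₁⟩⟩ := free_of_isNodalFormWithNodes_pair hnodF₂
  have h01 : q 0 ≠ 0 ∨ q 1 ≠ 0 := by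
    have hcase : (i₀ : ℕ) = 0 ∨ (i₀ : ℕ) = 1 := by omega
    rcases hcase with h0 | h0
    · left; have hi : i₀ = 0 := Fin.ext h0; rwa [hi] at hq₀
    · right; have hi : i₀ = 1 := Fin.ext h0; rwa [hi] at hq₀
  have h234 : q 2 ≠ 0 ∨ q 3 ≠ 0 ∨ q 4 ≠ 0 := by
    have hcase : (i₁ : ℕ) = 2 ∨ (i₁ : ℕ) = 3 ∨ (i₁ : ℕ) = 4 := by have := i₁.isLt; omega
    rcases hcase with h0 | h0 | h0
    · left; have hi : i₁ = 2 := Fin.ext h0; rwa [hi] at hq₁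
    · right; left; have hi : i₁ = 3 := Fin.ext h0; rwa [hi] at hq₁
    · right; right; have hi : i₁ = 4 := Fin.ext h0; rwa [hi] at hq₁
  have hsame : ∃ jj, MvPolynomial.eval (fun m' : M => coeff m'.1.1 f₃) (h jj) = 0 ∧
      MvPolynomial.eval (fun m' : M => coeff m'.1.1 F₂) (h jj) = 0 :=
    ⟨j₀, hj₀ f₃ ![1, 0, 1, 0, 0] hf₃ hM₃ (Or.inl (by simp)) (Or.inl (by simp)) hqplus.eval_pderiv,
      hj₀ F₂ q hF₂h hF₂M h01 h234 hqF.eval_pderiv⟩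
  have hgp₃' : MvPolynomial.eval ![1, 0, 1, 0, 0] g₃ ≠ 0 := by have := hgp₃ 0; rwa [Matrix.cons_val_zero] at this
  have hG₂q0 : MvPolynomial.eval q G₂ ≠ 0 := by have := hG₂q 0; rwa [Matrix.cons_val_zero] at this
  have hG₂q1 : MvPolynomial.eval (fun i => (γ i : ℂ) * q i) G₂ ≠ 0 := by
    have := hG₂q 1; rwa [Matrix.cons_val_one, Matrix.cons_val_fin_one] at this
  obtain ⟨γ₂, hγ₂, hc₂⟩ := exists_conj_transport_of_pairs hMC hD1 hd1 hirr hV hγ hw hirrh hna he hfac hU hf₃ hg₃ hM₃ hMg₃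
    hnod₃ hgp₃' hF₂h hG₂h hF₂M hG₂M hnodF₂ hG₂q0 hG₂q1 hsame hε' hε₂ hns' hns₂ β' hs' ω' hω' κ hs₂ ω₂ hpc₂ hT' hT₂
  -- the LINK algebra
  have hBdef : B = (cup Y 3 3).compr₂ (tr hY (3 + 3)) := rfl
  have hBalt : B.IsAlt := isAlt_tr_cup_of_odd hY ⟨1, by norm_num⟩
  have hBn : B.Nondegenerate := nondegenerate_tr_cup hY
  have h13' : B e₁ e₃ = 0 := by rw [hBdef, LinearMap.compr₂_apply]; exact h13
  have h12' : (c₀ * B e₁ e₂) ^ 2 = 1 := by rw [hBdef, LinearMap.compr₂_apply]; exact h12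
  have h23' : (c₀ * B e₂ e₃) ^ 2 = 1 := by rw [hBdef, LinearMap.compr₂_apply]; exact h23
  have h31 : B e₃ e₁ = 0 := by rw [← hBalt.neg_eq, h13', neg_zero]
  have hT₁eq : T₁ = oneParamTransvectionEquiv B (hBalt e₂) c₀ := LinearEquiv.ext fun x => by
    rw [hT₁x x, oneParamTransvectionEquiv_apply, hBdef, LinearMap.compr₂_apply]
  have hT₂eq : T₂ = oneParamTransvectionEquiv B (hBalt e₁) c₀ * oneParamTransvectionEquiv B (hBalt e₃) c₀ :=
    LinearEquiv.ext fun x => by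
      rw [hT₂x x, oneParamTransvectionEquiv_mul_apply_of_orthogonal B (hBalt e₁) (hBalt e₃) h31 c₀ x, hBdef,
        LinearMap.compr₂_apply, LinearMap.compr₂_apply]
  have hTfin : oneParamTransvectionEquiv B (hBalt r) c =
      γ₁⁻¹ * oneParamTransvectionEquiv B (hBalt e₂) c₀ * (γ₁⁻¹)⁻¹ := by
    have h1 : T = γ₁⁻¹ * T₁ * γ₁⁻¹⁻¹ := eq_inv_conj_of_eq_conj hc₁
    rw [hT₁eq] at h1
    exact hTeq.symm.trans h1
  have hT'fin : oneParamTransvectionEquiv B (hBalt δ) c' * oneParamTransvectionEquiv B (hBalt (τ δ)) c' =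
      γ₂⁻¹ * (oneParamTransvectionEquiv B (hBalt e₁) c₀ * oneParamTransvectionEquiv B (hBalt e₃) c₀) * (γ₂⁻¹)⁻¹ := by
    have h1 : T' = γ₂⁻¹ * T₂ * γ₂⁻¹⁻¹ := eq_inv_conj_of_eq_conj hc₂
    rw [hT₂eq] at h1
    exact hT'eq.symm.trans h1
  exact exists_link_of_conjugate_confluence hBalt hBn (by norm_num) hτ2 hτB hΓτ hΓB h13' h12' h23' hτr
    (inv_mem hγ₁) (inv_mem hγ₂) hTfin hT'fin

end Summit.HodgeConjecture.HodgeConjecture.Theorems.SignSymmetricPowersConfluenceLinkG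

end
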